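import Summits.QuantumFields.BalabanUV.T4Continuum.Support.ShellMeasureLandauEndAssembledDecayReachV6
import Summits.QuantumFields.BalabanUV.T4Continuum.Support.ShellMeasureLandauEndWindowReach

/-!
v6 RE-ROOT (owner R-ne7cp1-g37-1 (c3) «THE MIDDLE», unit `b2b-balaban-t4-ne7c-formalise-leaf-03` gen 9; chain suffix `V6`∕`_v6`,
R-ne7cp1-g37-3 (b)): THIS MODULE IS `ShellMeasureLandauEndAssembledDecayReachBox` (ROW S80 f6, leaf-03-g7) REGENERATED MECHANICALLY over link 1 `ShellMeasureLandauEndAssembledDecayReachV6` — the chain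
rooted at leaf-07-g10's S112 f3 `ShellMeasureLandauEndRayStokesAssembledDecayV6` (the Wilson budgets `hqW hk` in print's (53)–(54)
field-size shape, S112; the 𝓔-leg read on the w-tuple's pinned dress, S113 = leaf-01-g11's `ShellMeasureRayTermsPinnedLandauW`) — by
`g9/src/relink/relink.py` (the old surgery re-applied to the new host; ONE BY-NAME call; conclusion = the host's).  BINDER DIFF vs `ShellMeasureLandauEndAssembledDecayReachBox` (`linkdiff.py` on the bytes):
LEAVE = `Λe 𝔄 δ' ϖ hδ' hϖ 𝒴e' 𝒳e 𝒵e ℬe 𝒢e W𝒱e B₀e C₄e a₃e be h𝒢e hWe hB₀e hC₄e hbe H₁e hH₁e Φe rΦe hΦde hΦ0e hΦbe hSre ιe hιe He hHe`;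
ENTER = `hϖ0 hB𝒢w hBH₁w hBHw hιew`; TYPE-CHANGED = `hqW hk hdome hselfe hcontre Ce hCqe hqe hRCe Ef hEb supp hblind hdepth hK hcoupE hElb₁ hRdict`; conclusion = the
host's re-spelled slot constant.  No hand edit in this link.
HONEST (c3): re-wiring of OUR typed chain; nothing of Bałaban's asserted, cited or discharged; every CONTENT row stays displayed; NOTHING
in the countdown moves; NE7c NOT PRINTED, NOT PROVED; spine 0∕9.  THE OLD MODULE's DOCSTRING FOLLOWS VERBATIM FOR PROVENANCE (read
«imports X» as «imports X·V6»; its LEAVING∕ENTERING lists describe the OLD step, unchanged relative to the v6 host).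
# `T4Continuum.ShellMeasureLandauEndAssembledDecayReachBox` — «γ3 CARRIED TO THE MOST-ASSEMBLED END», file 2: the END-II-final
# ASSEMBLED AT THE READING OF RECORD (S80 f3) ON THE BLOCK'S BOX with NEITHER `hFsupp` NOR `hreach′` — displayed instead
# the γ3 PAIR of record (core reading from `u < θ`, collar support reading from `F ≠ 0`), a cover, the radius, S1's box data
(cell `pub-balaban`, sub-cell `t4`, spine estimate NE7c (node U5b); NE7c ROUND-2 crew, unit
`b2b-balaban-t4-ne7c-formalise-leaf-03` gen 7; owner table `t4/b2b-balaban-t4-ne7c-p1/LEAVES-NE7c-P1.md`: S80 f3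
`ShellMeasureLandauEndRayStokesAssembledDecay` p229913 = leaf-09-g12 (MOST-ASSEMBLED declaration of record, R-ne7cp1-g33-3);
S87 «audit γ3» f4 `ShellMeasureLandauEndWindowReach` p230388 = this lineage (γ3 FORM OF RECORD at the open-slot host, READ
leaf-05-g9 C-ne7cL05g9-4); S87 f5 `ShellMeasureWindowReachCollar` p229745 = leaf-01-g8; own-initiative OFFER journal l.19205
«γ3 CARRIED TO THE MOST-ASSEMBLED END», owner GO R-ne7cp1-g33-6 (b) l.19268 = **row S80 f6** (file 1 = S80 f5; ruling in
advance: on this file's landing + an XREAD outside leaf-03∕leaf-01, `…_assembled_decay_of_core_collar` becomes the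
MOST-ASSEMBLED DECLARATION OF RECORD — γ6 + S81 + γ3 carried; S80 f3 stays the window-binder form; S92 v1 keeps S80 f3);
ADDITIVE — imports file 1 `ShellMeasureLandauEndAssembledDecayReach` + S87 f4 ONLY
(S87 f4 brings `hreach'_of_core_collar` and, for (x1), `reach_family_inhabited` with leaf-10-g11's S89 toy box); [folklore];
0 `def`, 0 `def … : Prop`, 0 sorry, 0 citation tags)

HONEST FRAMING.  Finite four-torus programme, rung (B)+1 only — NOT infinite volume, NOT a mass gap, NOT the Clay
problem, NOT summit progress; (B), `BetaPertHyp`, (B^μ) not consumed.  NE7c (`T4IndicatorShell.ShellWeightBound`) is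
NOT PRINTED in [Balaban 1983–89] and NOT PROVED; «NE7c ⇐ the named binders» (trigger c3); (M1) realized ≠ NE7c.
Nothing printed is asserted: B14 (2.16)∕(2.17), B15 (1.3)–(1.9), [Balaban1985Averaging] Props 1∕2 and the scheme equation
numbers LOCATE the displayed SHAPES of binders; no estimate of Bałaban's is discharged.  HONEST DEPENDENCY (cell):
continuum YM on T⁴ ⇐ BetaPertH ∧ nine spine estimates (0/9 proved); BetaPertH ⇐ (D1) ∧ (D4) ∧ CAP+tail; G-an2-4 gates
asym, D1 and NE2/3/4.

WHAT THIS FILE PROVES (compositions BY NAME; ONE call each):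
* §1 **`slotAC_realized_su2_landauChart_assembled_decay_of_core_collar`** — file 1 `…_assembled_decay_of_reach'` AT
  `T := combBonds lo hi` (loop-free by `T4TreeGaugeFixing.noClosedLoop_combBonds` under the displayed non-wrapping
  `hi − lo < sitesPerDir`), `U₀ := 1`, `c := 1`, with `hreach′ := ShellMeasureWindowReachCollar.hreach'_of_core_collar`;
  binders = S80 f3's VERBATIM minus {`T hT U₀ c hFsupp`} plus EXACTLY S87 f4's box∕reading block {`hn`, `hN`, `hΛbox`,
  `hΛcomb`, `ha0`, `hrad`, `hcover`, `hcore`, `hcollar`} (the plaquette sets named `Pcore`∕`Pcollar` — S80 f3 uses `A` for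
  the (S78) dressed action); conclusion IDENTICAL to S80 f3's.  This is the most-assembled declaration of the END-II-final of
  record in its γ3 form: the window binder is GONE; what is displayed instead is located and of printed TYPE.
* §2 (x1) CREW RULE G-1 — the geometric family of §1 {`hn`, `hN`, `hΛbox`, `hΛcomb`, `hrad`, `hcover`, `hcore`, `hcollar`}
  is S87 f4's VERBATIM; its joint-inhabitation witness `ShellMeasureLandauEndWindowReach.reach_family_inhabited` (leaf-10-g11's
  `toyParams` side-2 box, `Λ := blockBonds ≠ ∅`, box plaquettes ≠ ∅, readings NON-VACUOUS, `hreach'_of_core_collar` FIRING)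
  is RE-FIRED here by name as an `example`; the END's own ≈ 200-binder family (S80 f3's) is jointly inhabited by leaf-01-g8's
  assembled-host toy `ShellMeasureLandauEndAssembledToy.slotAC_assembled_decay_toy` (journal l.19163) — by pointer, not
  imported.  A same-box junction witness (both families on ONE datum) is not claimed here (leaf-05-g9 INFO C-ne7cL05g9-4).
NOTHING in the countdown moves; NE7c NOT PROVED; spine PROVED 0∕9.
-/

noncomputable section

open Set Metric NormedSpace MeasureTheory Function

namespace Summit.QuantumFields.BalabanUV.T4Continuum.ShellMeasureLandauEndAssembledDecayReachBoxV6

open scoped ENNReal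
open Literature.MathematicalPhysics.QuantumFieldTheory.Balaban1983to89
open B11Prop6Scheme (Prop4Hyp)
open GaugeField (GaugeInvariant)
open T4ShellMeasure (SlotAntiConcentration)
open T4CubePoincare (cube)
open T4CubeChartGnomonic (SU2)
open T4CubeChartExp (expFibreChart)
open T4TreeGaugeFixing (NoClosedLoop fixTo noClosedLoop_combBonds)
open T4ShellMeasurePlaquette (expTail₂)
open ShellMeasureLevelAssembly (classifier)
open ShellMeasureMultiGridNorms (WSup)
open ShellMeasurePinnedNorm (pinW kerOpPin)
open ShellMeasureMultiGridNorms.WSup (toPiL)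
open ShellMeasureLandauHolonomy (solAt landauExp)
open ShellMeasureLandauHolonomyChart (holOf cplx)
open ShellMeasureLandauHolonomySkew (readOutReal)
open ShellMeasureRayTermsPinnedLandauW (hE_landau_chartRay_pinned_w)
open ShellMeasureRayLogIntegral (rayBound_of_logIntegral rayBound_add)
open ShellMeasureLandauEndFinal (slotAC_realized_su2_landauChart_final)
open ShellMeasureLandauEndRayStokesAssembled (wilsonProfile_nonneg)
open ShellMeasureDecayKernelSums (kerOp)
open ShellMeasureLandauWilsonSquaresKernelsSchwarzField (hE_landau_wilsonSquares_located_schwarz_of_decay_field)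
open ShellMeasureRayTermsPinnedLandau (hE_landau_chartRay_pinned)
open ShellMeasureLandauEndWindowRestrictRel (slotAC_realized_su2_landauChart_final_of_reach')
open T4AxialGaugeSmallField (boxPlaqs boxBonds)
open T4AxialGaugeFixing (combBonds)
open ShellMeasureWindowReachCollar (hreach'_of_core_collar)
open ShellMeasureLandauEndWindowReach (reach_family_inhabited)
open ShellMeasureLevelZeroBoxWitness (toyParams blockBonds boxPlaqF)
open ShellMeasureLandauEndAssembledDecayReachV6 (slotAC_realized_su2_landauChart_assembled_decay_v6_of_reach')

/-! ## §1 The most-assembled END on the block's box with the γ3 pair displayed -/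

section Box

open scoped Matrix.Norms.L2Operator

variable {P : Params} {j : ℕ} [DecidableEq (PBond P j)]
variable {n : Type*} [Fintype n] [DecidableEq n] [Nonempty n]
variable {𝒴 𝒴' 𝒳 𝒵 ℬ : Type*} [NormedAddCommGroup 𝒴] [NormedSpace ℂ 𝒴] [CompleteSpace 𝒴]
  [NormedAddCommGroup 𝒴'] [NormedSpace ℂ 𝒴'] [NormedAddCommGroup 𝒳] [NormedSpace ℂ 𝒳] [CompleteSpace 𝒳]
  [NormedAddCommGroup 𝒵] [NormedSpace ℂ 𝒵] [NormedAddCommGroup ℬ] [NormedSpace ℂ ℬ]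

/-- **END-II-FINAL, ASSEMBLED AT THE READING OF RECORD, ON THE BLOCK'S BOX WITH THE γ3 INPUT OF RECORD — core reading +
collar support reading** («γ3 carried to the most-assembled END», file 2).  File 1's END (`…_assembled_decay_of_reach'`,
support-relative reach) at the axial-comb tree gauge of the non-wrapping box `[lo, hi]` (`nb` unit steps per direction),
centre `1`, with its reach binder PRODUCED by leaf-01-g8's `ShellMeasureWindowReachCollar.hreach'_of_core_collar` from S1's
axial reach and the PAIR of located readings: CORE («`u < εθη²` at a comb-fixed section ⟹ the `Pcore`-plaquettes are
`a`-small», `Pcore ⊇ plaqs(□^∼)` — B14 (2.16)–(2.17) + [Balaban1985Averaging] Props 1∕2 TYPE) and COLLAR («`F ≠ 0` ⟹ the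
`Pcollar`-plaquettes are `a`-small» — the density's KEPT co-tests, B15 (1.3)–(1.9) TYPE; S2's level-0 precedent),
`boxPlaqs ⊆ Pcore ∪ Pcollar`, radius `(d−1)·nb·a ≤ 2 sin(S∕2)`.  Every other hypothesis is S80 f3's VERBATIM (at
`T := combBonds lo hi`, `U₀ := 1`, `c := 1`): the three scheme tuples, the decay kernels with their row sums, localities,
block support, blind read-outs, `K_w`, `LK`, `B_d`, lower bounds, co-test data, numbers, [dict], (SM) in the Stokes currency.
CONCLUSION — IDENTICAL to S80 f3's: (M1) per slot at `εθ·η²` with the slot constant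
`2(m₀ + (B_W⁽²⁾ + (3·LK·2z̄_e∕(r_Φ,e∕S − 1) + B_d)))∕(1 − δ)`.  CONDITIONAL on every binder; readings NOT asserted; NOT
Bałaban's minimiser; (M1) realized ≠ NE7c. [folklore] -/
theorem slotAC_realized_su2_landauChart_assembled_decay_v6_of_core_collar
    -- the BOX `[lo, hi]` (the block `□^{∼4}`: `nb` unit steps per direction, non-wrapping on the torus) and its axial comb
    {lo hi : Fin P.d → ℤ} {nb : ℕ} (hn : ∀ κ, hi κ ≤ lo κ + nb) (hN : ∀ κ, hi κ - lo κ < P.sitesPerDir j)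
    (Λ : Finset (PBond P j)) (hΛbox : ∀ b ∈ Λ, b ∈ boxBonds lo hi) (hΛcomb : Disjoint Λ (combBonds lo hi)) {m₀ : ℕ}
    (e : ↥Λ × Fin 3 ≃ Fin m₀) {S : ℝ} (hS : 0 < S) (hSπ : 3 * S ^ 2 < Real.pi ^ 2) {F : GaugeField P j SU2 → ℝ≥0∞}
    (hF : Measurable F) (hFi : GaugeInvariant F) {u : GaugeField P j SU2 → ℝ} (hu : Measurable u)
    (hui : GaugeInvariant u) {ι : Type*} {Pu : Finset ι} (hPu : Pu.Nonempty)
    (W : GaugeField P j SU2 → Set (Fin m₀ → ℝ)) (Jco : GaugeField P j SU2 → (Fin m₀ → ℝ) → ℝ≥0∞) {δ ρ β : ℝ}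
    (𝒢 : GaugeField P j SU2 → (𝒵 →L[ℂ] 𝒴)) (W𝒱 : GaugeField P j SU2 → 𝒴 → 𝒵) {B₀ C₄ a₃ ε₄ : ℝ}
    (h𝒢 : ∀ V f, ‖𝒢 V f‖ ≤ B₀ * ‖f‖) (hW : ∀ V, Prop4Hyp (W𝒱 V) C₄ a₃) (hB₀ : 0 < B₀) (hC₄ : 0 ≤ C₄) (hε₄ : 0 ≤ ε₄)
    {dL C₁ B₃ ε₁ : ℝ} (hdL : 0 ≤ dL) (hC₁ : 0 ≤ C₁) (hε₁ : 0 ≤ ε₁) (hB₃ : dL ≤ B₃) (h1 : 2 * B₀ * C₁ * B₃ * ε₁ ≤ ε₄)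
    (h2 : 4 * ε₄ ≤ a₃) (h3 : 16 * B₀ * C₄ * ε₄ ≤ 1) (H₁ : GaugeField P j SU2 → (ℬ →L[ℂ] 𝒴))
    (hH₁ : ∀ V B, ‖H₁ V B‖ ≤ B₀ * ‖B‖) (Φ : GaugeField P j SU2 → (Fin m₀ → ℂ) → ℬ) {rΦ : ℝ}
    (hΦd : ∀ V, DifferentiableOn ℂ (Φ V) (ball 0 rΦ)) (hΦ0 : ∀ V, Φ V 0 = 0)
    (hΦ : ∀ V, ∀ z ∈ ball (0 : Fin m₀ → ℂ) rΦ, ‖Φ V z‖ < 2 * dL * C₁ * ε₁) (hSr : S < rΦ)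
    (Cf : GaugeField P j SU2 → 𝒴' → 𝒳) {C₂ RC : ℝ} (hC₂ : 0 ≤ C₂)
    (hCq : ∀ V, ∀ Z : 𝒴', ‖Z‖ < RC → ‖Cf V Z‖ ≤ C₂ * ‖Z‖ ^ 2) (hCd : ∀ V, DifferentiableOn ℂ (Cf V) (ball 0 RC))
    (ιs : GaugeField P j SU2 → (𝒴 →L[ℂ] 𝒴')) (hι : ∀ V Y, ‖ιs V Y‖ ≤ ‖Y‖) (Hop : GaugeField P j SU2 → (𝒳 →L[ℂ] 𝒴))
    (hH : ∀ V X, ‖Hop V X‖ ≤ B₀ * ‖X‖) {ε₃ : ℝ} (h18 : 18 * C₂ * B₀ * ε₃ ≤ 1)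
    (hcoup : ε₄ + B₀ * (2 * dL * C₁ * ε₁) ≤ ε₃) (h3R : 3 * ε₃ ≤ RC) (ℓs : ι → List (𝒴 →L[ℂ] Matrix n n ℂ)) {κr : ℝ}
    (hκ : 0 ≤ κr) (hℓ : ∀ p ∈ Pu, ∀ ℓ ∈ ℓs p, ∀ Y, ‖ℓ Y‖ ≤ κr * ‖Y‖) {m : ℕ} (hlen : ∀ p ∈ Pu, (ℓs p).length ≤ m)
    {κc : ℝ} (hκc : 0 ≤ κc) (hcurl : ∀ p ∈ Pu, ∀ Y, ‖((ℓs p).map fun ℓ => ℓ Y).sum‖ ≤ κc * ‖Y‖)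
    -- ══ (T2) THE WILSON SLOT'S SUPPLIER DATA AT THE READING OF RECORD (file 4
    -- `ShellMeasureLandauWilsonSquaresKernelsSchwarz.hE_landau_wilsonSquares_located_schwarz_of_decay`, per exterior section `V`,
    -- V-uniform constants): five FLAT pi-type chain spaces, ONE pin profile on a common position space (one-sided Lipschitz),
    -- the four linear letters as V-indexed DECAY KERNELS with reduced-rate row sums ((3.133)∕Thm 3.3, (46), (103) decay-halves
    -- TYPE — LOCATORS), the flat printed-TYPE lists, two localities with reaches, the block support of the coarse field, blind
    -- flat read-outs, the located count — NOTHING PINNED DISPLAYED; the Wilson budget LOCATED and SECOND ORDER (γ6) ══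
    {Λw Λz Λw' Λx Λb 𝔖 : Type*} [Fintype Λw] [DecidableEq Λw] [Fintype Λz] [Fintype Λw'] [Fintype Λx] [Fintype Λb]
    {𝔄w ℭ 𝔄' 𝔅 𝔇 : Type*} [NormedAddCommGroup 𝔄w] [NormedSpace ℂ 𝔄w] [CompleteSpace 𝔄w] [NormedAddCommGroup ℭ]
    [NormedSpace ℂ ℭ] [NormedAddCommGroup 𝔄'] [NormedSpace ℂ 𝔄'] [NormedAddCommGroup 𝔅] [NormedSpace ℂ 𝔅]
    [CompleteSpace 𝔅] [NormedAddCommGroup 𝔇] [NormedSpace ℂ 𝔇] {δw : ℝ} (hδw : 0 ≤ δw) (ϖw : 𝔖 → ℝ) (dis : 𝔖 → 𝔖 → ℝ)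
    (hϖw : ∀ x y, ϖw x ≤ ϖw y + dis x y) (pos : Λw → 𝔖) (posz : Λz → 𝔖) (pos' : Λw' → 𝔖) (posx : Λx → 𝔖)
    (posb : Λb → 𝔖) (k𝒢 : GaugeField P j SU2 → Λw → Λz → (ℭ →L[ℂ] 𝔄w))
    (kι : GaugeField P j SU2 → Λw' → Λw → (𝔄w →L[ℂ] 𝔄')) (kH : GaugeField P j SU2 → Λw → Λx → (𝔅 →L[ℂ] 𝔄w))
    (kH₁ : GaugeField P j SU2 → Λw → Λb → (𝔇 →L[ℂ] 𝔄w)) {c𝒢 δ𝒢 M𝒢 cι δι Mι cH δH MH cH₁ δH₁ MH₁ : ℝ} (hc𝒢 : 0 ≤ c𝒢)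
    (hM𝒢 : 0 ≤ M𝒢) (hk𝒢 : ∀ V c b', ‖k𝒢 V c b'‖ ≤ c𝒢 * Real.exp (-(δ𝒢 * dis (pos c) (posz b'))))
    (hM𝒢' : ∀ x, ∑ b', Real.exp (-((δ𝒢 - δw) * dis x (posz b'))) ≤ M𝒢) (hcι : 0 ≤ cι) (hMι : 0 ≤ Mι)
    (hkι : ∀ V c b', ‖kι V c b'‖ ≤ cι * Real.exp (-(δι * dis (pos' c) (pos b'))))
    (hMι' : ∀ x, ∑ b', Real.exp (-((δι - δw) * dis x (pos b'))) ≤ Mι) (hcH : 0 ≤ cH) (hMH : 0 ≤ MH)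
    (hkH : ∀ V c b', ‖kH V c b'‖ ≤ cH * Real.exp (-(δH * dis (pos c) (posx b'))))
    (hMH' : ∀ x, ∑ b', Real.exp (-((δH - δw) * dis x (posx b'))) ≤ MH) (hcH₁ : 0 ≤ cH₁) (hMH₁ : 0 ≤ MH₁)
    (hkH₁ : ∀ V c b', ‖kH₁ V c b'‖ ≤ cH₁ * Real.exp (-(δH₁ * dis (pos c) (posb b'))))
    (hMH₁' : ∀ x, ∑ b', Real.exp (-((δH₁ - δw) * dis x (posb b'))) ≤ MH₁)
    -- the flat lists (P2)∕(P4)∕(118)∕(121)∕(103)∕(75)-TYPE∕(44) at radius `RCw` with `6(ε₄w + B₀w·bw) ≤ RCw`∕scaling∕(46)∕(54)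
    (W𝒱w : GaugeField P j SU2 → (Λw → 𝔄w) → (Λz → ℭ)) {B₀w C₄w a₃w ε₄w bw : ℝ}
    (h𝒢w : ∀ V f, ‖kerOp (k𝒢 V) f‖ ≤ B₀w * ‖f‖) (hWw : ∀ V, Prop4Hyp (W𝒱w V) C₄w a₃w) (hB₀w : 0 < B₀w)
    (hC₄w : 0 ≤ C₄w) (hε₄w : 0 ≤ ε₄w) (hdomw : 2 * (ε₄w + B₀w * bw) ≤ a₃w)
    (hselfw : B₀w * C₄w * (ε₄w + B₀w * bw) ^ 2 ≤ ε₄w) (hcontrw : 4 * B₀w * C₄w * (ε₄w + B₀w * bw) < 1)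
    (hH₁w : ∀ V B, ‖kerOp (kH₁ V) B‖ ≤ B₀w * ‖B‖) (Φw : GaugeField P j SU2 → (Fin m₀ → ℂ) → (Λb → 𝔇)) {rΦw : ℝ}
    (hΦdw : ∀ V, DifferentiableOn ℂ (Φw V) (ball 0 rΦw)) (hΦ0w : ∀ V, Φw V 0 = 0)
    (hΦbw : ∀ V, ∀ z ∈ ball (0 : Fin m₀ → ℂ) rΦw, ‖Φw V z‖ < bw) (h2Sw : 2 * S ≤ rΦw)
    (Cw : GaugeField P j SU2 → (Λw' → 𝔄') → (Λx → 𝔅)) {C₂w RCw : ℝ} (hC₂w : 0 ≤ C₂w)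
    (hCqw : ∀ V, ∀ Z : Λw' → 𝔄', ‖Z‖ < RCw → ‖Cw V Z‖ ≤ C₂w * ‖Z‖ ^ 2)
    (hCdw : ∀ V, DifferentiableOn ℂ (Cw V) (ball 0 RCw)) (hιw : ∀ V Y, ‖kerOp (kι V) Y‖ ≤ ‖Y‖)
    (hHw : ∀ V X, ‖kerOp (kH V) X‖ ≤ B₀w * ‖X‖) (hqw : 9 * C₂w * B₀w * (ε₄w + B₀w * bw) < 1)
    (hRCw : 6 * (ε₄w + B₀w * bw) ≤ RCw)
    -- localities with reaches, the block support, the two contraction numbers (DISPLAYED arithmetic on the decay constants)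
    (NW : Λz → Λw → Prop)
    (hlocW : ∀ V, ∀ A A' : Λw → 𝔄w, ∀ c', (∀ b', NW c' b' → A b' = A' b') → W𝒱w V A c' = W𝒱w V A' c') {rW : ℝ}
    (hreachW : ∀ c' b', NW c' b' → ϖw (posz c') - rW ≤ ϖw (pos b')) (NC : Λx → Λw' → Prop)
    (hlocC : ∀ V, ∀ A A' : Λw' → 𝔄', ∀ c', (∀ b', NC c' b' → A b' = A' b') → Cw V A c' = Cw V A' c') {rC : ℝ}
    (hreachC : ∀ c' b', NC c' b' → ϖw (posx c') - rC ≤ ϖw (pos' b'))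
    (hsupp : ∀ V, ∀ z : Fin m₀ → ℂ, ∀ i, 0 < ϖw (posb i) → Φw V z i = 0)
    (hqW : c𝒢 * M𝒢 * (4 * C₄w * (ε₄w + B₀w * bw) * Real.exp (δw * rW)) < 1)
    (hk : 12 * C₂w * (ε₄w + B₀w * bw) * Real.exp (δw * rC) * (cι * Mι) * (cH * MH) < 1)
    -- weight plaquettes; read-outs BLIND off located supports, FLAT op-norms, curl op-norm (DISPLAYED; `κ_c ∝ η²`), lengths
    {𝔭 : Type*} (Pw : Finset 𝔭) (ℓw : 𝔭 → List ((Λw → 𝔄w) →L[ℂ] Matrix n n ℂ)) (suppw : 𝔭 → Finset Λw) (ϖPw : 𝔭 → ℝ)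
    (hblindw : ∀ p ∈ Pw, ∀ ℓ ∈ ℓw p, ∀ A A' : Λw → 𝔄w, (∀ b' ∈ suppw p, A b' = A' b') → ℓ A = ℓ A')
    (hdepthw : ∀ p ∈ Pw, ∀ b' ∈ suppw p, ϖPw p ≤ ϖw (pos b')) (hϖPw : ∀ p ∈ Pw, 0 ≤ ϖPw p) {κwb κcb : ℝ}
    (hκwb : 0 ≤ κwb) (hκcb : 0 ≤ κcb) (hℓwb : ∀ p ∈ Pw, ∀ ℓ ∈ ℓw p, ‖ℓ‖ ≤ κwb) (hcurlw : ∀ p ∈ Pw, ‖(ℓw p).sum‖ ≤ κcb)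
    {mw : ℕ} (hlenw : ∀ p ∈ Pw, (ℓw p).length ≤ mw)
    -- the global tuple's real structure with SKEW weight read-outs
    (𝓡𝒴w : AddSubgroup (Λw → 𝔄w)) (h𝓡𝒴w : IsClosed (𝓡𝒴w : Set (Λw → 𝔄w))) (𝓡𝒵w : AddSubgroup (Λz → ℭ))
    (𝓡𝒴w' : AddSubgroup (Λw' → 𝔄')) (𝓡𝒳w : AddSubgroup (Λx → 𝔅)) (h𝓡𝒳w : IsClosed (𝓡𝒳w : Set (Λx → 𝔅)))
    (𝓡ℬw : AddSubgroup (Λb → 𝔇)) (h𝒢rw : ∀ V, ∀ f ∈ 𝓡𝒵w, kerOp (k𝒢 V) f ∈ 𝓡𝒴w) (hWrw : ∀ V, ∀ Y ∈ 𝓡𝒴w, W𝒱w V Y ∈ 𝓡𝒵w)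
    (hιrw : ∀ V, ∀ Y ∈ 𝓡𝒴w, kerOp (kι V) Y ∈ 𝓡𝒴w') (hHrw : ∀ V, ∀ X ∈ 𝓡𝒳w, kerOp (kH V) X ∈ 𝓡𝒴w)
    (hCrw : ∀ V, ∀ Z ∈ 𝓡𝒴w', Cw V Z ∈ 𝓡𝒳w) (hH₁rw : ∀ V, ∀ B ∈ 𝓡ℬw, kerOp (kH₁ V) B ∈ 𝓡𝒴w)
    (hΦrw : ∀ V, ∀ y : Fin m₀ → ℝ, ‖y‖ ≤ S → Φw V (cplx y) ∈ 𝓡ℬw)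
    (hskew : ∀ p ∈ Pw, ∀ ℓ ∈ ℓw p, ∀ Y ∈ 𝓡𝒴w, ℓ Y ∈ skewAdjoint (Matrix n n ℂ))
    -- the frozen background plaquettes (N-ne7cp1-g31-2) with a uniform size bound, the located count, `0 ≤ β`
    (Bp : GaugeField P j SU2 → 𝔭 → Matrix n n ℂ) {d : 𝔭 → ℝ} {dbar : ℝ}
    (hBu : ∀ V, ∀ p ∈ Pw, Bp V p ∈ unitary (Matrix n n ℂ)) (hBd : ∀ V, ∀ p ∈ Pw, ‖Bp V p - 1‖ ≤ d p)
    (hd : ∀ p ∈ Pw, d p ≤ dbar) (hdbar : 0 ≤ dbar) {Kw : ℝ} (hKw : ∑ p ∈ Pw, Real.exp (-(δw * ϖPw p)) ≤ Kw)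
    -- ══ (T3) THE LOCATED NON-WILSON TERMS — THE 𝓔-LEG READ OFF THE w-TUPLE's KERNELS IN THE PINNED DRESS (S113, leaf-01-g11:
    -- `hE_landau_chartRay_pinned_w`): ONE exponent field; the e-tuple's carriers and letters are GONE; ENTERING the pin sign, the three
    -- Schur number junctions (S108's rows, born here) and the pinned restriction row; the e-leg's own numbers, its Landau-correction
    -- pair (between the pinned spaces), the TERM rows and the coupling STAY ══
    (hϖ0 : ∀ x, 0 ≤ ϖw x) (hB𝒢w : c𝒢 * M𝒢 ≤ B₀w) (hBH₁w : cH₁ * MH₁ ≤ B₀w) (hBHw : cH * MH ≤ B₀w) {ε₄e : ℝ}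
    (hε₄e : 0 ≤ ε₄e) (hdome : 2 * (ε₄e + B₀w * bw) ≤ a₃w)
    (hselfe : B₀w * (C₄w * Real.exp (δw * rW)) * (ε₄e + B₀w * bw) ^ 2 ≤ ε₄e)
    (hcontre : 4 * B₀w * (C₄w * Real.exp (δw * rW)) * (ε₄e + B₀w * bw) < 1)
    (Ce : GaugeField P j SU2 → WSup (pinW δw (ϖw ∘ pos')) 1 𝔄' → WSup (pinW δw (ϖw ∘ posx)) 1 𝔅) {C₂e RCe : ℝ}
    (hC₂e : 0 ≤ C₂e) (hCqe : ∀ V, ∀ Z : WSup (pinW δw (ϖw ∘ pos')) 1 𝔄', ‖Z‖ < RCe → ‖Ce V Z‖ ≤ C₂e * ‖Z‖ ^ 2)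
    (hCde : ∀ V, DifferentiableOn ℂ (Ce V) (ball 0 RCe))
    (hιew : ∀ V, ∀ Y : WSup (pinW δw (ϖw ∘ pos)) 1 𝔄w, ‖kerOpPin (kι V) δw (ϖw ∘ pos) (ϖw ∘ pos') Y‖ ≤ ‖Y‖)
    (hqe : 9 * C₂e * B₀w * (ε₄e + B₀w * bw) < 1) (hRCe : 3 * (ε₄e + B₀w * bw) ≤ RCe) {𝔱 : Type*} (I : Finset 𝔱)
    {Ef : 𝔱 → (Λw → 𝔄w) → ℂ} {rE : ℝ} {ee : 𝔱 → ℝ} (hrE : 0 < rE)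
    (hEd : ∀ i ∈ I, DifferentiableOn ℂ (Ef i) (ball 0 rE))
    (hEb : ∀ i ∈ I, ∀ Z ∈ ball (0 : Λw → 𝔄w) rE, ‖Ef i Z‖ ≤ ee i) (he0 : ∀ i ∈ I, 0 ≤ ee i) (supp : 𝔱 → Finset Λw)
    (hblind : ∀ i ∈ I, ∀ A₁ A₂ : Λw → 𝔄w, (∀ b' ∈ supp i, A₁ b' = A₂ b') → Ef i A₁ = Ef i A₂) (ϖP : 𝔱 → ℝ)
    (hdepth : ∀ i ∈ I, ∀ b' ∈ supp i, ϖP i ≤ ϖw (pos b')) {LK : ℝ} (hLK : 0 ≤ LK)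
    (hK : ∑ i ∈ I, 2 * ee i / rE * Real.exp (-(δw * ϖP i)) ≤ LK)
    (hcoupE : ((ε₄e + B₀w * bw) + B₀w * (4 * C₂e * (ε₄e + B₀w * bw) ^ 2)) ≤ rE / 2) {BE₁ : ℝ}
    (hElb₁ : ∀ V (y : Fin m₀ → ℝ), ‖y‖ ≤ S → -BE₁ ≤
      (∑ i ∈ I, Ef i (WSup.toPiL (pinW δw (ϖw ∘ pos)) 1 (landauExp (Ce V)
        (kerOpPin (kι V) δw (ϖw ∘ pos) (ϖw ∘ pos')) (kerOpPin (kH V) δw (ϖw ∘ posx) (ϖw ∘ pos))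
        (4 * C₂e * (ε₄e + B₀w * bw) ^ 2)
        (solAt (kerOpPin (k𝒢 V) δw (ϖw ∘ posz) (ϖw ∘ pos)) 0
          (fun Y : WSup (pinW δw (ϖw ∘ pos)) 1 𝔄w =>
            ((toPiL (pinW δw (ϖw ∘ posz)) 1).symm (W𝒱w V (toPiL (pinW δw (ϖw ∘ pos)) 1 Y)) : WSup (pinW δw (ϖw ∘ posz)) 1 ℭ))
          ε₄e (0 : WSup (pinW δw (ϖw ∘ posz)) 1 ℭ)
          (kerOpPin (kH₁ V) δw (ϖw ∘ posb) (ϖw ∘ pos) ((toPiL (pinW δw (ϖw ∘ posb)) 1).symm (Φw V (cplx y)))) +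
            kerOpPin (kH₁ V) δw (ϖw ∘ posb) (ϖw ∘ pos) ((toPiL (pinW δw (ϖw ∘ posb)) 1).symm (Φw V (cplx y))))))).re)
    -- ══ (S78) THE FLUCTUATION-DRESSED TERMS: `−log ∫ g e^{A} dμ` with an ω-UNIFORM ray constant `B_d`, integrability and
    -- positivity of the dressed integral, a lower bound on the S-ball (all DISPLAYED) ══
    {Ω : Type*} [MeasurableSpace Ω] (μ : Measure Ω) {g : Ω → ℝ} (hg : ∀ ω, 0 ≤ g ω)
    (A : GaugeField P j SU2 → (Fin m₀ → ℝ) → Ω → ℝ) {Bd : ℝ} (hBd0 : 0 ≤ Bd)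
    (hint : ∀ V, ∀ x ∈ W V, ∀ c : ℝ, 1 / 2 ≤ c → c ≤ 1 → Integrable (fun ω => g ω * Real.exp (A V (c • x) ω)) μ)
    (hpos : ∀ V, ∀ x ∈ W V, ∀ c : ℝ, 1 / 2 ≤ c → c ≤ 1 → 0 < ∫ ω, g ω * Real.exp (A V (c • x) ω) ∂μ)
    (hA : ∀ V, ∀ x ∈ W V, ∀ c : ℝ, 1 / 2 ≤ c → c ≤ 1 → ∀ ω, A V x ω ≤ A V (c • x) ω + (1 - c) * Bd) {BE₂ : ℝ}
    (hElb₂ : ∀ V (y : Fin m₀ → ℝ), ‖y‖ ≤ S → -BE₂ ≤ (-Real.log (∫ ω, g ω * Real.exp (A V y ω) ∂μ)))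
    (L : Set (𝒴 →L[ℂ] Matrix n n ℂ)) (𝓡𝒵 : AddSubgroup 𝒵) (𝓡𝒴' : AddSubgroup 𝒴') (𝓡𝒳 : AddSubgroup 𝒳)
    (h𝓡𝒳 : IsClosed (𝓡𝒳 : Set 𝒳)) (𝓡ℬ : AddSubgroup ℬ) (h𝒢r : ∀ V, ∀ f ∈ 𝓡𝒵, 𝒢 V f ∈ readOutReal L)
    (hWr : ∀ V, ∀ Y ∈ readOutReal L, W𝒱 V Y ∈ 𝓡𝒵) (hιr : ∀ V, ∀ Y ∈ readOutReal L, ιs V Y ∈ 𝓡𝒴')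
    (hHr : ∀ V, ∀ X ∈ 𝓡𝒳, Hop V X ∈ readOutReal L) (hCr : ∀ V, ∀ Z ∈ 𝓡𝒴', Cf V Z ∈ 𝓡𝒳)
    (hH₁r : ∀ V, ∀ B ∈ 𝓡ℬ, H₁ V B ∈ readOutReal L) (hΦr : ∀ V, ∀ y : Fin m₀ → ℝ, ‖y‖ ≤ S → Φ V (cplx y) ∈ 𝓡ℬ)
    (hRdict : ∀ V, ∀ x ∈ cube m₀ S, F (fixTo (combBonds lo hi) 1 (updateFinset V Λ (expFibreChart Λ 1 e x))) = Jco V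
      x * ENNReal.ofReal (Real.exp (-((∑ p ∈ Pw, β * (1 - (Matrix.trace (Bp V p * holOf (ℓw p) (fun y =>
      landauExp (Cw V) (kerOp (kι V)) (kerOp (kH V)) (4 * C₂w * (ε₄w + B₀w * bw) ^ 2) (solAt (kerOp (k𝒢 V)) 0
      (W𝒱w V) ε₄w (0 : Λz → ℭ) (kerOp (kH₁ V) (Φw V (cplx y))) + kerOp (kH₁ V) (Φw V (cplx y)))) x)).re /
      Fintype.card n)) + ((∑ i ∈ I, Ef i (WSup.toPiL (pinW δw (ϖw ∘ pos)) 1 (landauExp (Ce V) (kerOpPin (kι V)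
      δw (ϖw ∘ pos) (ϖw ∘ pos')) (kerOpPin (kH V) δw (ϖw ∘ posx) (ϖw ∘ pos)) (4 * C₂e * (ε₄e + B₀w * bw) ^ 2)
      (solAt (kerOpPin (k𝒢 V) δw (ϖw ∘ posz) (ϖw ∘ pos)) 0 (fun Y : WSup (pinW δw (ϖw ∘ pos)) 1 𝔄w => ((toPiL
      (pinW δw (ϖw ∘ posz)) 1).symm (W𝒱w V (toPiL (pinW δw (ϖw ∘ pos)) 1 Y)) : WSup (pinW δw (ϖw ∘ posz)) 1 ℭ))
      ε₄e (0 : WSup (pinW δw (ϖw ∘ posz)) 1 ℭ) (kerOpPin (kH₁ V) δw (ϖw ∘ posb) (ϖw ∘ pos) ((toPiL (pinW δw (ϖw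
      ∘ posb)) 1).symm (Φw V (cplx x)))) + kerOpPin (kH₁ V) δw (ϖw ∘ posb) (ϖw ∘ pos) ((toPiL (pinW δw (ϖw ∘
      posb)) 1).symm (Φw V (cplx x))))))).re + (-Real.log (∫ ω, g ω * Real.exp (A V x ω) ∂μ)))))))
    (hudict : ∀ V, ∀ x ∈ cube m₀ S,
      u (fixTo (combBonds lo hi) 1 (updateFinset V Λ (expFibreChart Λ 1 e x))) =
        classifier hPu (fun p => holOf (ℓs p) (fun y => landauExp (Cf V) (ιs V) (Hop V)
          (4 * C₂ * (ε₄ + B₀ * (2 * dL * C₁ * ε₁)) ^ 2)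
          (solAt (𝒢 V) 0 (W𝒱 V) ε₄ (0 : 𝒵) (H₁ V (Φ V (cplx y))) + H₁ V (Φ V (cplx y))))) x)
    (hJW : ∀ V x, Jco V x ≠ 0 → x ∈ W V) (hJ : ∀ V x, ∀ a : ℝ, 0 ≤ a → Jco V x ≤ Jco V (Real.exp (-a) • x))
    (hJ1 : ∀ V x, Jco V x ≤ 1) (hWS : ∀ V, W V ⊆ closedBall (0 : Fin m₀ → ℝ) S) (hδ0 : 0 ≤ δ) (hδ1 : δ < 1)
    (hρ0 : 0 ≤ ρ) (hρ : ρ ≤ (1 - δ) / 2) (hβ : 0 ≤ β)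
    -- SM-L2 (SM) DISCHARGED IN THE STOKES CURRENCY (S73 `hSM_of_stokes`): the η-scalings of the classifier's read-out data
    -- DISPLAYED — curl read-out × field size `κ_c·z̄ ≤ c₁η²z` (B11 (25)∕(37) TYPE), letter size `κ_r·z̄ ≤ c₂ηz` ((19) TYPE),
    -- regime `m·κ_r·z̄ ≤ 1` — the UNIT-currency smallness `36(c₁z + m²c₂²z²)∕(r_Φ∕S − 1)² ≤ δ·εθ`, and the classifier
    -- threshold `θ := εθ·η²` (B14 (2.17) TYPE): the `η²` CANCELS
    {η εθ c₁ c₂ z : ℝ} (hη : 0 < η) (hεθ : 0 < εθ)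
    (hs₁ : κc * ((ε₄ + B₀ * (2 * dL * C₁ * ε₁)) + B₀ * (4 * C₂ * (ε₄ + B₀ * (2 * dL * C₁ * ε₁)) ^ 2)) ≤ c₁ * η ^ 2 * z)
    (ha : κr * ((ε₄ + B₀ * (2 * dL * C₁ * ε₁)) + B₀ * (4 * C₂ * (ε₄ + B₀ * (2 * dL * C₁ * ε₁)) ^ 2)) ≤ c₂ * η * z)
    (hma : m * (κr * ((ε₄ + B₀ * (2 * dL * C₁ * ε₁)) + B₀ * (4 * C₂ * (ε₄ + B₀ * (2 * dL * C₁ * ε₁)) ^ 2))) ≤ 1)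
    (hsm : 36 * (c₁ * z + m ^ 2 * c₂ ^ 2 * z ^ 2) / (rΦ / S - 1) ^ 2 ≤ δ * εθ)
    -- THE DISPLAYED γ3 INPUT OF RECORD (N-ne7cp1-g32-2 ∕ N-ne7cp1-g33-2 «COLLAR»; leaf-01-g8 l.18489, leaf-08-g14 l.18568):
    -- radius `(d−1)·nb·a ≤ 2 sin(S∕2)`, a cover of the box plaquettes by a CORE set (⊇ the plaquettes of `□^∼`) and a COLLAR
    -- set, and the PAIR of readings — «sub-threshold ⟹ core plaquettes `a`-small» (B14 (2.16)–(2.17) + average regularity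
    -- [Balaban1985Averaging] Props 1∕2 TYPE, from `u < θ`) and «`F ≠ 0` ⟹ collar plaquettes `a`-small» (the density's KEPT
    -- co-tests, B15 (1.3)–(1.9) TYPE — a SUPPORT property); located, NOT asserted — REPLACE `hreach′` of file 1 (hence
    -- `hFsupp` of S80 f3); binder NAMES = S87 f4's (`hn hN hΛbox hΛcomb ha0 hrad hcover hcore hcollar`; the two plaquette
    -- sets are called `Pcore`∕`Pcollar` here because S80 f3 already uses `A` for the (S78) dressed action)
    {a : ℝ} (ha0 : 0 ≤ a) (hrad : ((P.d - 1 : ℕ) : ℝ) * nb * a ≤ 2 * Real.sin (S / 2))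
    {Pcore Pcollar : Set (Plaq P j)} (hcover : boxPlaqs lo hi ⊆ Pcore ∪ Pcollar)
    (hcore : ∀ (V : GaugeField P j SU2) (y : ↥Λ → SU2),
      u (fixTo (combBonds lo hi) 1 (updateFinset V Λ y)) < εθ * η ^ 2 →
        PlaqSmallOn Pcore a (fixTo (combBonds lo hi) 1 (updateFinset V Λ y)))
    (hcollar : ∀ (V : GaugeField P j SU2) (y : ↥Λ → SU2),
      F (fixTo (combBonds lo hi) 1 (updateFinset V Λ y)) ≠ 0 →
        PlaqSmallOn Pcollar a (fixTo (combBonds lo hi) 1 (updateFinset V Λ y))) :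
    SlotAntiConcentration ((fieldMeasure P j SU2).withDensity F) u (εθ * η ^ 2) ρ
      (2 * ((m₀ : ℝ) + (3 * (|β| * ((dbar +
          2 * (κcb * (cH₁ * MH₁ * bw / ((1 - c𝒢 * M𝒢 * (4 * C₄w * (ε₄w + B₀w * bw) * Real.exp (δw * rW))) *
              (1 - 12 * C₂w * (ε₄w + B₀w * bw) * Real.exp (δw * rC) * (cι * Mι) * (cH * MH)))) +
            expTail₂ (mw * (κwb * (cH₁ * MH₁ * bw / ((1 - c𝒢 * M𝒢 * (4 * C₄w * (ε₄w + B₀w * bw) * Real.exp (δw * rW))) *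
              (1 - 12 * C₂w * (ε₄w + B₀w * bw) * Real.exp (δw * rC) * (cι * Mι) * (cH * MH))))))) / (rΦw / S)) *
          (2 * (κcb * (cH₁ * MH₁ * bw / ((1 - c𝒢 * M𝒢 * (4 * C₄w * (ε₄w + B₀w * bw) * Real.exp (δw * rW))) *
              (1 - 12 * C₂w * (ε₄w + B₀w * bw) * Real.exp (δw * rC) * (cι * Mι) * (cH * MH)))) +
            expTail₂ (mw * (κwb * (cH₁ * MH₁ * bw / ((1 - c𝒢 * M𝒢 * (4 * C₄w * (ε₄w + B₀w * bw) * Real.exp (δw * rW))) *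
              (1 - 12 * C₂w * (ε₄w + B₀w * bw) * Real.exp (δw * rC) * (cι * Mι) * (cH * MH))))))) / (rΦw / S))) * Kw) +
        (3 * (LK * (2 * ((ε₄e + B₀w * bw) + B₀w * (4 * C₂e * (ε₄e + B₀w * bw) ^ 2)))) / (rΦw / S - 1) + Bd))) / (1 - δ)) :=
  slotAC_realized_su2_landauChart_assembled_decay_v6_of_reach' (noClosedLoop_combBonds hN) 1 Λ e hS hSπ (fun _ => 1)
    hF hFi hu hui hPu W Jco 𝒢 W𝒱 h𝒢 hW hB₀ hC₄ hε₄ hdL hC₁ hε₁ hB₃ h1 h2 h3 H₁ hH₁ Φ hΦd hΦ0 hΦ hSr Cf hC₂ hCq hCd ιs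
    hι Hop hH h18 hcoup h3R ℓs hκ hℓ hlen hκc hcurl hδw ϖw dis hϖw pos posz pos' posx posb k𝒢 kι kH kH₁ hc𝒢 hM𝒢 hk𝒢
    hM𝒢' hcι hMι hkι hMι' hcH hMH hkH hMH' hcH₁ hMH₁ hkH₁ hMH₁' W𝒱w h𝒢w hWw hB₀w hC₄w hε₄w hdomw hselfw hcontrw hH₁w
    Φw hΦdw hΦ0w hΦbw h2Sw Cw hC₂w hCqw hCdw hιw hHw hqw hRCw NW hlocW hreachW NC hlocC hreachC hsupp hqW hk Pw ℓw
    suppw ϖPw hblindw hdepthw hϖPw hκwb hκcb hℓwb hcurlw hlenw 𝓡𝒴w h𝓡𝒴w 𝓡𝒵w 𝓡𝒴w' 𝓡𝒳w h𝓡𝒳w 𝓡ℬw h𝒢rw hWrw hιrw hHrw hCrw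
    hH₁rw hΦrw hskew Bp hBu hBd hd hdbar hKw hϖ0 hB𝒢w hBH₁w hBHw hε₄e hdome hselfe hcontre Ce hC₂e hCqe hCde hιew hqe
    hRCe I hrE hEd hEb he0 supp hblind ϖP hdepth hLK hK hcoupE hElb₁ μ hg A hBd0 hint hpos hA hElb₂ L 𝓡𝒵 𝓡𝒴' 𝓡𝒳 h𝓡𝒳 𝓡ℬ
    h𝒢r hWr hιr hHr hCr hH₁r hΦr hRdict hudict hJW hJ hJ1 hWS hδ0 hδ1 hρ0 hρ hβ hη hεθ (hreach'_of_core_collar hn Λ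
    hΛbox hΛcomb ha0 hrad hcover F hcore hcollar) hs₁ ha hma hsm

end Box

/-! ## §2 (x1) Crew rule G-1: the box∕reading family of §1 is S87 f4's — its witness re-fired by name -/

section Witness

open scoped Matrix.Norms.L2Operator

/-- **(x1) RULE G-1 FOR §1's GEOMETRIC FAMILY** — it is S87 f4's family VERBATIM, so its joint-inhabitation witness is
S87 f4 `ShellMeasureLandauEndWindowReach.reach_family_inhabited`, RE-FIRED here by name: on leaf-10-g11's concrete torus
`toyParams` (`d = 2`, six sites per direction) at level `0`, the side-2 box at corner `0` — `hn` (`nb = 2`), the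
non-wrapping `hN`, `NoClosedLoop (combBonds …)`, the block `Λ := blockBonds` NONEMPTY, `hΛbox`, `hΛcomb`, `3·1² < π²`,
`a := sin(1∕2) > 0` with `(d−1)·nb·a ≤ 2 sin(S∕2)` at `S = 1`, the box plaquettes NONEMPTY, and the PAIR of readings
inhabited NON-VACUOUSLY (core: `u :=` the box maximum of `dist1(U(∂p))`, `θ := a`; collar: `F := 𝟙{PlaqSmallOn box a}`;
cover `box ⊆ box ∪ box`) with `hreach'_of_core_collar` FIRING on them.  The END's own binder family (S80 f3's) is jointly
inhabited by leaf-01-g8's `ShellMeasureLandauEndAssembledToy.slotAC_assembled_decay_toy` (not imported). [folklore] -/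
example [DecidableEq (PBond toyParams 0)] :
    (∀ κ, (fun _ : Fin toyParams.d => (0 : ℤ) + 2) κ ≤ (0 : Fin toyParams.d → ℤ) κ + ((2 : ℕ) : ℤ)) ∧
    (∀ κ, (fun _ : Fin toyParams.d => (0 : ℤ) + 2) κ - (0 : Fin toyParams.d → ℤ) κ < (toyParams.sitesPerDir 0 : ℤ)) ∧
    NoClosedLoop (combBonds (P := toyParams) (j := 0) 0 (fun _ => (0 : ℤ) + 2)) ∧
    (blockBonds (P := toyParams) (j := 0) 0 (fun _ => (0 : ℤ) + 2)).Nonempty ∧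
    (∀ b ∈ blockBonds (P := toyParams) (j := 0) 0 (fun _ => (0 : ℤ) + 2),
      b ∈ boxBonds (P := toyParams) (j := 0) 0 (fun _ => (0 : ℤ) + 2)) ∧
    Disjoint (blockBonds (P := toyParams) (j := 0) 0 (fun _ => (0 : ℤ) + 2)) (combBonds 0 (fun _ => (0 : ℤ) + 2)) ∧
    3 * (1 : ℝ) ^ 2 < Real.pi ^ 2 ∧ 0 < Real.sin (1 / 2) ∧
    ((toyParams.d - 1 : ℕ) : ℝ) * (2 : ℕ) * Real.sin (1 / 2) ≤ 2 * Real.sin (1 / 2) ∧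
    ∃ hPu : (boxPlaqF (P := toyParams) (j := 0) 0 (fun _ => (0 : ℤ) + 2)).Nonempty,
      ∀ (V : GaugeField toyParams 0 SU2) (y : ↥(blockBonds (P := toyParams) (j := 0) 0 (fun _ => (0 : ℤ) + 2)) → SU2),
        (boxPlaqF (P := toyParams) (j := 0) 0 (fun _ => (0 : ℤ) + 2)).sup' hPu (fun p => dist1 (GaugeField.plaqHol
          (fixTo (combBonds 0 (fun _ => (0 : ℤ) + 2)) 1 (updateFinset V _ y)) p)) < Real.sin (1 / 2) →
        ({W : GaugeField toyParams 0 SU2 | PlaqSmallOn (boxPlaqs 0 (fun _ => (0 : ℤ) + 2)) (Real.sin (1 / 2)) W}.indicator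
          (1 : GaugeField toyParams 0 SU2 → ℝ≥0∞)) (fixTo (combBonds 0 (fun _ => (0 : ℤ) + 2)) 1 (updateFinset V _ y)) ≠ 0 →
        ∀ b (hb : b ∈ blockBonds (P := toyParams) (j := 0) 0 (fun _ => (0 : ℤ) + 2)),
          dist1 (((1 : GaugeField toyParams 0 SU2) b)⁻¹ * y ⟨b, hb⟩) ≤ 2 * Real.sin (1 / 2) :=
  reach_family_inhabited

end Witness

end Summit.QuantumFields.BalabanUV.T4Continuum.ShellMeasureLandauEndAssembledDecayReachBoxV6

end
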